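import Summits.ValiantsHypothesis.ValiantsHypothesis.Theorems.FeketeSOSFeketeSOSHardPaleyRIPBridge
import Summits.ValiantsHypothesis.ValiantsHypothesis.Theorems.FeketeSOSFeketeSOSHardPaleyRIPHalfBarrier
import Summits.ValiantsHypothesis.ValiantsHypothesis.Theorems.FeketeSOSFeketeSOSHardPaleyRIPFlatRIPPaleyClique
import Mathlib.NumberTheory.LegendreSymbol.QuadraticChar.Basic
import HarnessLib

/-!
# The Paley graph conjecture below the `1/2` barrier as a NAMED HYPOTHESIS, and route FeketeSOS's line
# `paley-rip` as a conditional bridge on it (crux `FeketeSOSHard`, stmt-ValiantsHypothesis-3996)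

For an odd prime `p` let `χ` be the quadratic character of `𝔽_p` (Mathlib's `quadraticChar (ZMod p)`).
The **Paley graph property** `𝒫_p(α, β)` with constant `C` (Satake 2024, Def. 14; Chor–Goldreich 1988 §3)
asks `|∑_{s∈S,t∈T} χ(s − t)| ≤ C·p^{−β}·|S|·|T|` for all `S, T ⊆ 𝔽_p` with `|S|, |T| > p^α` — a
power-saving two-source extractor / discrepancy bound for the Paley graph at min-entropy rate `α`.  It
is a THEOREM for every `α > 1/2` (Chor–Goldreich; here `paleyGraphProperty_of_half_lt`, from the
completion bound) and OPEN for every `α < 1/2`; the **Paley graph conjecture** asserts it for all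
`α ∈ (0,1]`, and its weakest new case — SOME `α < 1/2` — is Chor–Goldreich's 1988 problem of breaking the
`1/2` barrier, known (Satake 2021/2024, Bandeira–Mixon–Moreira 2017) to be tied to the Paley-ETF
restricted isometry property beyond `√p` (Conjecture 14 of Bandeira's 2025 open-problem list).

* `PaleyGraphProperty`, `@[conjecture] PaleyGraphConjecture`, `@[conjecture] PaleyGraphConjectureBelowHalf`
  — the vocabulary (no conjecture is asserted);
* `paleyGraphProperty_of_half_lt` — `𝒫_p(α, α − 1/2)` with `C = 1` at EVERY prime for every `α > 1/2`;
* `paleyGraphConjectureBelowHalf_iff_smallSetDiffDiscrepancy` — translation to the `ℕ`-indexed format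
  of the line's files (`Finset ℕ` inside `[0,p)`, Legendre symbols, saving `(#A·#B)^{−β/2}`);
* `flatRIP_iff_paleyGraphConjectureBelowHalf` — **the engine `stub_paleyFlatRIP` of line `paley-rip`
  IS this conjecture** (kernel equivalence, via `flatRIP_iff_smallSetDiffDiscrepancy`);
* `feketeSOSHard_of_paleyGraphConjectureBelowHalf_of_tameOperator` — the line as a CONDITIONAL BRIDGE:
  `PaleyGraphConjectureBelowHalf → stub_tameOperator → FeketeSOSHard`;
* `paleyClique_card_le_of_paleyGraphConjectureBelowHalf` — the conjecture bounds Paley cliques by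
  `p^{1/2−κ} + 1` (`paleyClique_card_le_of_flatRIP`).

Honest framing: `PaleyGraphConjecture(BelowHalf)` are OPEN conjectures filed as named hypotheses; the
crux `FeketeSOSHard` and `stub_tameOperator` remain open; the bridge is conditional; nothing here bears
on `VP ≠ VNP`.
-/

-- the line's namespace repeats a path segment by convention (same as the other paley-rip files)
set_option linter.dupNamespace false

namespace Summit.ValiantsHypothesis.ValiantsHypothesis.Theorems

open Finset Polynomial
open scoped BigOperators
open Summit.ValiantsHypothesis.ValiantsHypothesis.Theorems.FeketeSOSHardPaleyRIP
open Summit.ValiantsHypothesis.ValiantsHypothesis.Theses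

noncomputable section

/-! ## The vocabulary -/

/-- **The Paley graph property `𝒫_p(α, β)` with constant `C`** (Satake 2024, Definition 14; Chor–Goldreich
1988 §3): for all `S, T ⊆ 𝔽_p` with `|S|, |T| > p^α`,
`|∑_{s∈S} ∑_{t∈T} χ(s − t)| ≤ C · p^{−β} · |S| · |T|`, `χ = quadraticChar (ZMod p)`.
[cite: Satake2024PaleyExtractor, Definition 14] -/
def PaleyGraphProperty (p : ℕ) [Fact p.Prime] (α β C : ℝ) : Prop :=
  ∀ (S T : Finset (ZMod p)), (p : ℝ) ^ α < (S.card : ℝ) → (p : ℝ) ^ α < (T.card : ℝ) →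
    |∑ s ∈ S, ∑ t ∈ T, ((quadraticChar (ZMod p) (s - t) : ℤ) : ℝ)| ≤
      C * (p : ℝ) ^ (-β) * (S.card : ℝ) * (T.card : ℝ)

/-- **The Paley graph conjecture** (OPEN; Satake 2024, Remark 16, after Chor–Goldreich 1988 and Chung
1994, Conj. 2.2): for every `α ∈ (0,1]` there are `β, C > 0` such that `𝒫_p(α, β)` with constant `C`
holds at all sufficiently large primes.  Known only for `α > 1/2`.
[cite: Satake2024PaleyExtractor, Remark 16] -/
@[conjecture] def PaleyGraphConjecture : Prop :=
  ∀ α : ℝ, 0 < α → α ≤ 1 → ∃ β : ℝ, 0 < β ∧ ∃ C : ℝ, 0 < C ∧ ∃ p₁ : ℕ,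
    ∀ (p : ℕ) [Fact p.Prime], p₁ ≤ p → PaleyGraphProperty p α β C

/-- **The Paley graph conjecture below the `1/2` barrier** (OPEN; Chor–Goldreich's problem of two-source
extraction from the Paley graph below min-entropy rate `1/2`, Satake 2024, Problem 8 / Corollary 21):
for SOME `α < 1/2` there are `β, C > 0` with `𝒫_p(α, β)` (constant `C`) at all sufficiently large primes.
[cite: Satake2024PaleyExtractor, Corollary 21] -/
@[conjecture] def PaleyGraphConjectureBelowHalf : Prop :=
  ∃ α : ℝ, α < 1 / 2 ∧ ∃ β : ℝ, 0 < β ∧ ∃ C : ℝ, 0 < C ∧ ∃ p₁ : ℕ,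
    ∀ (p : ℕ) [Fact p.Prime], p₁ ≤ p → PaleyGraphProperty p α β C

/-- Monotonicity in the size exponent: `𝒫_p(α, β)` implies `𝒫_p(α', β)` for `α ≤ α'`. [folklore] -/
theorem PaleyGraphProperty.mono {p : ℕ} [Fact p.Prime] {α α' β C : ℝ} (hαα' : α ≤ α')
    (h : PaleyGraphProperty p α β C) : PaleyGraphProperty p α' β C := by
  intro S T hS hT
  have hp1 : (1 : ℝ) ≤ (p : ℝ) := by exact_mod_cast (Fact.out : p.Prime).one_lt.le
  have hmono : (p : ℝ) ^ α ≤ (p : ℝ) ^ α' := Real.rpow_le_rpow_of_exponent_le hp1 hαα'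
  exact h S T (hmono.trans_lt hS) (hmono.trans_lt hT)

/-! ## Translation between `Finset (ZMod p)` and `ℕ`-indexed sums -/

namespace PaleyGraph

section Translate

variable (p : ℕ) [Fact p.Prime]

/-- The quadratic character of `𝔽_p` at `a − b` is the Legendre symbol `(a − b | p)`. [folklore] -/
theorem quadraticChar_natCast_sub (a b : ℕ) :
    quadraticChar (ZMod p) ((a : ZMod p) - (b : ZMod p)) = legendreSym p ((a : ℤ) - b) := by
  unfold legendreSym
  push_cast
  rfl

/-- `ZMod.val` is injective on any finset of `ZMod p`. [folklore] -/
theorem val_injOn (S : Finset (ZMod p)) : Set.InjOn (ZMod.val : ZMod p → ℕ) (S : Set (ZMod p)) :=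
  fun _ _ _ _ h => ZMod.val_injective p h

/-- The `ℕ`-image of a vertex set: elements `< p`, same cardinality. [folklore] -/
theorem image_val_lt (S : Finset (ZMod p)) : ∀ a ∈ S.image ZMod.val, a < p := by
  intro a ha
  obtain ⟨s, _, rfl⟩ := mem_image.1 ha
  exact ZMod.val_lt s

/-- The `ℕ`-image of a vertex set has the same cardinality. [folklore] -/
theorem card_image_val (S : Finset (ZMod p)) : (S.image ZMod.val).card = S.card :=
  card_image_of_injOn (val_injOn p S)

/-- The character sum over `S × T ⊆ 𝔽_p²` equals the Legendre-symbol sum over the `ℕ`-images.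
[folklore] -/
theorem charSum_image_val (S T : Finset (ZMod p)) :
    ∑ a ∈ S.image ZMod.val, ∑ b ∈ T.image ZMod.val, ((legendreSym p ((a : ℤ) - b) : ℤ) : ℝ) =
      ∑ s ∈ S, ∑ t ∈ T, ((quadraticChar (ZMod p) (s - t) : ℤ) : ℝ) := by
  rw [sum_image (val_injOn p S)]
  refine sum_congr rfl fun s _ => ?_
  rw [sum_image (val_injOn p T)]
  refine sum_congr rfl fun t _ => ?_
  rw [← quadraticChar_natCast_sub p, ZMod.natCast_zmod_val, ZMod.natCast_zmod_val]

/-- The complex norm of a Legendre-symbol sum is the absolute value of the real one. [folklore] -/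
theorem norm_diffCharSum_eq_abs (A B : Finset ℕ) :
    ‖∑ a ∈ A, ∑ b ∈ B, ((legendreSym p ((a : ℤ) - b) : ℤ) : ℂ)‖ =
      |∑ a ∈ A, ∑ b ∈ B, ((legendreSym p ((a : ℤ) - b) : ℤ) : ℝ)| := by
  have h : ∑ a ∈ A, ∑ b ∈ B, ((legendreSym p ((a : ℤ) - b) : ℤ) : ℂ) =
      ((∑ a ∈ A, ∑ b ∈ B, ((legendreSym p ((a : ℤ) - b) : ℤ) : ℝ) : ℝ) : ℂ) := by push_cast; rfl
  rw [h, Complex.norm_real, Real.norm_eq_abs]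

/-- `ℕ`-sets inside `[0,p)` cast injectively into `ZMod p`. [folklore] -/
theorem natCast_injOn (A : Finset ℕ) (hA : ∀ a ∈ A, a < p) :
    Set.InjOn (fun a : ℕ => (a : ZMod p)) (A : Set ℕ) := by
  intro a ha b hb h
  dsimp only at h
  have h' := congrArg ZMod.val h
  rwa [ZMod.val_cast_of_lt (hA a ha), ZMod.val_cast_of_lt (hA b hb)] at h'

/-- Casting an `ℕ`-set inside `[0,p)` into `ZMod p` preserves cardinality. [folklore] -/
theorem card_image_natCast (A : Finset ℕ) (hA : ∀ a ∈ A, a < p) :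
    (A.image (fun a : ℕ => (a : ZMod p))).card = A.card :=
  card_image_of_injOn (natCast_injOn p A hA)

/-- The Legendre-symbol sum over `A × B ⊆ [0,p)²` equals the character sum over the cast sets.
[folklore] -/
theorem charSum_image_natCast (A B : Finset ℕ) (hA : ∀ a ∈ A, a < p) (hB : ∀ b ∈ B, b < p) :
    ∑ s ∈ A.image (fun a : ℕ => (a : ZMod p)), ∑ t ∈ B.image (fun b : ℕ => (b : ZMod p)),
        ((quadraticChar (ZMod p) (s - t) : ℤ) : ℝ) =
      ∑ a ∈ A, ∑ b ∈ B, ((legendreSym p ((a : ℤ) - b) : ℤ) : ℝ) := by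
  rw [sum_image (natCast_injOn p A hA)]
  refine sum_congr rfl fun a _ => ?_
  rw [sum_image (natCast_injOn p B hB)]
  refine sum_congr rfl fun b _ => ?_
  rw [quadraticChar_natCast_sub p]

/-- A vertex set has at most `p` elements. [folklore] -/
theorem card_le_prime (S : Finset (ZMod p)) : (S.card : ℝ) ≤ p := by
  have h := Finset.card_le_univ S
  rw [ZMod.card] at h
  exact_mod_cast h

end Translate

end PaleyGraph

open PaleyGraph

/-! ## The `1/2` barrier in this vocabulary -/

/-- **Chor–Goldreich 1988**: for every `α > 1/2` and EVERY prime `p`, `𝒫_p(α, α − 1/2)` holds with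
constant `1` (from `smallSetDiffDiscrepancy_of_half_lt`, i.e. the completion bound). [folklore] -/
theorem paleyGraphProperty_of_half_lt (α : ℝ) (hα : 1 / 2 < α) (p : ℕ) [Fact p.Prime] :
    PaleyGraphProperty p α (α - 1 / 2) 1 := by
  classical
  intro S T hS hT
  have hprime : p.Prime := Fact.out
  have hp0 : (0 : ℝ) < (p : ℝ) := by exact_mod_cast hprime.pos
  have hα0 : 0 < α := by linarith
  set A := S.image ZMod.val with hAdef
  set B := T.image ZMod.val with hBdef
  have hAc : (A.card : ℝ) = S.card := by rw [card_image_val p S]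
  have hBc : (B.card : ℝ) = T.card := by rw [card_image_val p T]
  have h := smallSetDiffDiscrepancy_of_half_lt α hα p A B (image_val_lt p S) (image_val_lt p T)
    (by rw [hAc]; exact hS.le) (by rw [hBc]; exact hT.le)
  rw [norm_diffCharSum_eq_abs, charSum_image_val, hAc, hBc] at h
  -- `(xy)^{1 − (1 − 1/(2α))/2} = xy · (xy)^{−(α−1/2)/(2α)} ≤ xy · p^{−(α − 1/2)}`
  have hx : (p : ℝ) ^ α < S.card := hS
  have hy : (p : ℝ) ^ α < T.card := hT
  have hpα : 0 < (p : ℝ) ^ α := Real.rpow_pos_of_pos hp0 α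
  have hxy : (p : ℝ) ^ (2 * α) ≤ (S.card : ℝ) * T.card := by
    have := mul_le_mul hx.le hy.le hpα.le (hpα.le.trans hx.le)
    rwa [← Real.rpow_add hp0, show α + α = 2 * α by ring] at this
  have hxy0 : 0 < (S.card : ℝ) * T.card := lt_of_lt_of_le (Real.rpow_pos_of_pos hp0 _) hxy
  have hexp : (1 : ℝ) - (1 - 1 / (2 * α)) / 2 = 1 + (-(α - 1 / 2) / (2 * α)) := by
    field_simp; ring
  have hneg : -(α - 1 / 2) / (2 * α) ≤ 0 :=
    div_nonpos_of_nonpos_of_nonneg (by linarith) (by linarith)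
  have hpow : ((S.card : ℝ) * T.card) ^ (-(α - 1 / 2) / (2 * α)) ≤ (p : ℝ) ^ (-(α - 1 / 2)) := by
    calc ((S.card : ℝ) * T.card) ^ (-(α - 1 / 2) / (2 * α))
        ≤ ((p : ℝ) ^ (2 * α)) ^ (-(α - 1 / 2) / (2 * α)) :=
          Real.rpow_le_rpow_of_nonpos (Real.rpow_pos_of_pos hp0 _) hxy hneg
      _ = (p : ℝ) ^ (-(α - 1 / 2)) := by
          rw [← Real.rpow_mul hp0.le]; congr 1; field_simp
  calc |∑ s ∈ S, ∑ t ∈ T, ((quadraticChar (ZMod p) (s - t) : ℤ) : ℝ)|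
      ≤ ((S.card : ℝ) * T.card) ^ (1 - (1 - 1 / (2 * α)) / 2) := h
    _ = ((S.card : ℝ) * T.card) * ((S.card : ℝ) * T.card) ^ (-(α - 1 / 2) / (2 * α)) := by
        rw [hexp, Real.rpow_add hxy0, Real.rpow_one]
    _ ≤ ((S.card : ℝ) * T.card) * (p : ℝ) ^ (-(α - 1 / 2)) :=
        mul_le_mul_of_nonneg_left hpow hxy0.le
    _ = 1 * (p : ℝ) ^ (-(α - 1 / 2)) * (S.card : ℝ) * (T.card : ℝ) := by ring

/-! ## The conjecture in the line's `ℕ`-indexed format, the engine, the bridge -/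

/-- **`PaleyGraphConjectureBelowHalf` ⟺ the `ℕ`-indexed small-set difference discrepancy for some
`α < 1/2`** (the format of `…PaleyRIPSmallSetEquiv.lean`: `A, B ⊆ [0,p)` as finsets of naturals,
Legendre symbols, `#A, #B ≥ p^α`, saving `(#A·#B)^{−β/2}`).  `→`: raise `α` to `α'' ∈ (max(α,0), 1/2)`
to pass from `>` to `≥`, and `C·p^{−β} ≤ p^{−β/2} ≤ (#A#B)^{−β/4}` for large `p`; `←`: raise `α` to
`≥ 1/4` and use `(#A#B)^{−β/2} ≤ p^{−αβ}`. [folklore] -/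
theorem paleyGraphConjectureBelowHalf_iff_smallSetDiffDiscrepancy :
    PaleyGraphConjectureBelowHalf ↔
    (∃ α : ℝ, α < 1 / 2 ∧ ∃ β : ℝ, 0 < β ∧ ∃ p₁ : ℕ, ∀ (p : ℕ) [Fact p.Prime], p₁ ≤ p →
      ∀ (A B : Finset ℕ), (∀ a ∈ A, a < p) → (∀ b ∈ B, b < p) →
        (p : ℝ) ^ α ≤ (A.card : ℝ) → (p : ℝ) ^ α ≤ (B.card : ℝ) →
        ‖∑ a ∈ A, ∑ b ∈ B, ((legendreSym p ((a : ℤ) - b) : ℤ) : ℂ)‖ ≤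
          ((A.card : ℝ) * B.card) ^ (1 - β / 2)) := by
  classical
  constructor
  · rintro ⟨α, hα, β, hβ, C, hC, p₁, hP⟩
    -- raise `α` to `α'' ∈ (max α 0, 1/2)` and absorb `C` into half of `β`
    set α₀ : ℝ := max α 0 with hα₀
    have hα₀lt : α₀ < 1 / 2 := max_lt hα (by norm_num)
    set α'' : ℝ := (α₀ + 1 / 2) / 2 with hα''
    have hα''lt : α'' < 1 / 2 := by rw [hα'']; linarith
    have hα₀α'' : α₀ < α'' := by rw [hα'']; linarith
    obtain ⟨N, hN⟩ : ∃ N : ℕ, C ^ (1 / (β / 2)) ≤ (N : ℝ) := ⟨_, Nat.le_ceil _⟩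
    refine ⟨α'', hα''lt, β / 2, by positivity, max p₁ (max N 2), ?_⟩
    intro p _ hp A B hA hB hAc hBc
    have hprime : p.Prime := Fact.out
    have hp0 : (0 : ℝ) < (p : ℝ) := by exact_mod_cast hprime.pos
    have hp1 : (1 : ℝ) < (p : ℝ) := by exact_mod_cast hprime.one_lt
    have hp₁ : p₁ ≤ p := le_trans (le_max_left _ _) hp
    have hpN : (N : ℝ) ≤ p := by exact_mod_cast le_trans (le_trans (le_max_left _ _) (le_max_right _ _)) hp
    -- the property at `α₀` (monotone from `α`)
    have hP₀ : PaleyGraphProperty p α₀ β C := (hP p hp₁).mono (le_max_left _ _)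
    -- strict size hypotheses
    have hstrict : (p : ℝ) ^ α₀ < (p : ℝ) ^ α'' := Real.rpow_lt_rpow_of_exponent_lt hp1 hα₀α''
    set S := A.image (fun a : ℕ => (a : ZMod p)) with hSdef
    set T := B.image (fun b : ℕ => (b : ZMod p)) with hTdef
    have hSc : (S.card : ℝ) = A.card := by rw [card_image_natCast p A hA]
    have hTc : (T.card : ℝ) = B.card := by rw [card_image_natCast p B hB]
    have hmain := hP₀ S T (by rw [hSc]; exact hstrict.trans_le hAc) (by rw [hTc]; exact hstrict.trans_le hBc)
    rw [charSum_image_natCast p A B hA hB, hSc, hTc] at hmain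
    rw [norm_diffCharSum_eq_abs]
    -- `C p^{−β} ≤ p^{−β/2} ≤ (xy)^{−β/4}` since `C ≤ p^{β/2}` and `xy ≤ p²`
    set x : ℝ := (A.card : ℝ) with hx
    set y : ℝ := (B.card : ℝ) with hy
    have hpα : 0 < (p : ℝ) ^ α'' := Real.rpow_pos_of_pos hp0 _
    have hxpos : 0 < x := lt_of_lt_of_le hpα hAc
    have hypos : 0 < y := lt_of_lt_of_le hpα hBc
    have hxy0 : 0 < x * y := mul_pos hxpos hypos
    have hxle : x ≤ p := by have h := card_le_prime p S; rwa [hSc] at h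
    have hyle : y ≤ p := by have h := card_le_prime p T; rwa [hTc] at h
    have hxyle : x * y ≤ (p : ℝ) ^ (2 : ℝ) := by
      rw [show (2 : ℝ) = (2 : ℕ) by norm_num, Real.rpow_natCast, sq]
      exact mul_le_mul hxle hyle hypos.le hp0.le
    have hCle : C ≤ (p : ℝ) ^ (β / 2) := by
      have h0 : (0 : ℝ) ≤ C ^ (1 / (β / 2)) := Real.rpow_nonneg hC.le _
      calc C = (C ^ (1 / (β / 2))) ^ (β / 2) := by
            rw [one_div, Real.rpow_inv_rpow hC.le (by positivity)]
        _ ≤ (p : ℝ) ^ (β / 2) := Real.rpow_le_rpow h0 (hN.trans hpN) (by positivity)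
    have hpow : (p : ℝ) ^ (-(β / 2)) ≤ (x * y) ^ (-(β / 2 / 2)) := by
      calc (p : ℝ) ^ (-(β / 2)) = ((p : ℝ) ^ (2 : ℝ)) ^ (-(β / 2 / 2)) := by
            rw [← Real.rpow_mul hp0.le]; ring_nf
        _ ≤ (x * y) ^ (-(β / 2 / 2)) := Real.rpow_le_rpow_of_nonpos hxy0 hxyle (by linarith)
    have hsplit : (x * y) ^ (1 - β / 2 / 2) = x * y * (x * y) ^ (-(β / 2 / 2)) := by
      rw [show (1 : ℝ) - β / 2 / 2 = 1 + (-(β / 2 / 2)) by ring, Real.rpow_add hxy0, Real.rpow_one]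
    have hCp : C * (p : ℝ) ^ (-β) ≤ (p : ℝ) ^ (-(β / 2)) := by
      have h1 : C * (p : ℝ) ^ (-β) ≤ (p : ℝ) ^ (β / 2) * (p : ℝ) ^ (-β) :=
        mul_le_mul_of_nonneg_right hCle (Real.rpow_nonneg hp0.le _)
      rw [← Real.rpow_add hp0] at h1
      rw [show -(β / 2) = β / 2 + -β by ring]
      exact h1
    calc |∑ a ∈ A, ∑ b ∈ B, ((legendreSym p ((a : ℤ) - b) : ℤ) : ℝ)|
        ≤ C * (p : ℝ) ^ (-β) * x * y := hmain
      _ = x * y * (C * (p : ℝ) ^ (-β)) := by ring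
      _ ≤ x * y * (p : ℝ) ^ (-(β / 2)) := mul_le_mul_of_nonneg_left hCp hxy0.le
      _ ≤ x * y * (x * y) ^ (-(β / 2 / 2)) := mul_le_mul_of_nonneg_left hpow hxy0.le
      _ = (x * y) ^ (1 - β / 2 / 2) := hsplit.symm
  · rintro ⟨α, hα, β, hβ, p₁, hD⟩
    -- raise `α` to `α' = max α (1/4)` so that the saving is a power of `p`
    set α' : ℝ := max α (1 / 4) with hα'
    have hα'lt : α' < 1 / 2 := max_lt hα (by norm_num)
    have hα'pos : 0 < α' := lt_of_lt_of_le (by norm_num) (le_max_right _ _)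
    refine ⟨α', hα'lt, α' * β, by positivity, 1, one_pos, p₁, ?_⟩
    intro p _ hp S T hS hT
    have hprime : p.Prime := Fact.out
    have hp0 : (0 : ℝ) < (p : ℝ) := by exact_mod_cast hprime.pos
    have hp1 : (1 : ℝ) ≤ (p : ℝ) := by exact_mod_cast hprime.one_lt.le
    set A := S.image ZMod.val with hAdef
    set B := T.image ZMod.val with hBdef
    have hAc : (A.card : ℝ) = S.card := by rw [card_image_val p S]
    have hBc : (B.card : ℝ) = T.card := by rw [card_image_val p T]
    have hmono : (p : ℝ) ^ α ≤ (p : ℝ) ^ α' := Real.rpow_le_rpow_of_exponent_le hp1 (le_max_left _ _)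
    have h := hD p hp A B (image_val_lt p S) (image_val_lt p T)
      (by rw [hAc]; exact hmono.trans hS.le) (by rw [hBc]; exact hmono.trans hT.le)
    rw [norm_diffCharSum_eq_abs, charSum_image_val, hAc, hBc] at h
    set x : ℝ := (S.card : ℝ) with hx
    set y : ℝ := (T.card : ℝ) with hy
    have hpα : 0 < (p : ℝ) ^ α' := Real.rpow_pos_of_pos hp0 _
    have hxy : (p : ℝ) ^ (2 * α') ≤ x * y := by
      have := mul_le_mul hS.le hT.le hpα.le (hpα.le.trans hS.le)
      rwa [← Real.rpow_add hp0, show α' + α' = 2 * α' by ring] at this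
    have hxy0 : 0 < x * y := lt_of_lt_of_le (Real.rpow_pos_of_pos hp0 _) hxy
    have hpow : (x * y) ^ (-(β / 2)) ≤ (p : ℝ) ^ (-(α' * β)) := by
      calc (x * y) ^ (-(β / 2)) ≤ ((p : ℝ) ^ (2 * α')) ^ (-(β / 2)) :=
            Real.rpow_le_rpow_of_nonpos (Real.rpow_pos_of_pos hp0 _) hxy (by linarith)
        _ = (p : ℝ) ^ (-(α' * β)) := by rw [← Real.rpow_mul hp0.le]; ring_nf
    calc |∑ s ∈ S, ∑ t ∈ T, ((quadraticChar (ZMod p) (s - t) : ℤ) : ℝ)|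
        ≤ (x * y) ^ (1 - β / 2) := h
      _ = x * y * (x * y) ^ (-(β / 2)) := by
          rw [show (1 : ℝ) - β / 2 = 1 + (-(β / 2)) by ring, Real.rpow_add hxy0, Real.rpow_one]
      _ ≤ x * y * (p : ℝ) ^ (-(α' * β)) := mul_le_mul_of_nonneg_left hpow hxy0.le
      _ = 1 * (p : ℝ) ^ (-(α' * β)) * x * y := by ring

/-- **The engine of line `paley-rip` IS the Paley graph conjecture below `1/2`.**  The registered statement
of `stub_paleyFlatRIP` (flat restricted isometry of the Paley–Hankel form beyond `√p`) holds iff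
`PaleyGraphConjectureBelowHalf`. [folklore] -/
theorem flatRIP_iff_paleyGraphConjectureBelowHalf :
    (∃ κ : ℝ, 0 < κ ∧ ∃ δ₁ : ℝ, 0 < δ₁ ∧ ∃ p₁ : ℕ, ∀ (p : ℕ) [Fact p.Prime], p₁ ≤ p →
      ∀ (S : Finset ℕ), (∀ a ∈ S, a < p) → (S.card : ℝ) ≤ (p : ℝ) ^ (1 / 2 + δ₁) →
      ∀ (w : ℕ → ℂ), ‖paleyForm p S w‖ ≤ (p : ℝ) ^ (1 / 2 - κ) * ∑ a ∈ S, ‖w a‖ ^ 2) ↔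
    PaleyGraphConjectureBelowHalf :=
  flatRIP_iff_smallSetDiffDiscrepancy.trans paleyGraphConjectureBelowHalf_iff_smallSetDiffDiscrepancy.symm

/-- **Line `paley-rip` as a conditional bridge.**  `PaleyGraphConjectureBelowHalf` together with operator
tameness (`stub_tameOperator` of the registered skeleton, verbatim) proves the crux `FeketeSOSHard`.
[folklore] -/
theorem feketeSOSHard_of_paleyGraphConjectureBelowHalf_of_tameOperator
    (hP : PaleyGraphConjectureBelowHalf)
    (hT : ∀ ε : ℝ, 0 < ε → ∃ K : ℝ, 0 < K ∧ ∀ (p : ℕ) [Fact p.Prime] (r : ℕ) (S : Finset ℕ),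
      (∀ a ∈ S, a < p) → ∀ (c : Fin r → ℂ) (w : Fin r → ℂ[X]), (∀ i, (w i).support ⊆ S) →
      ∀ (F : ℂ[X]) (M : ℝ), F.natDegree < p → ((X : ℂ[X]) ^ p - 1 ∣ (∑ i, C (c i) * w i ^ 2) - F) →
        (∀ n, ‖F.coeff n‖ ≤ M) →
        ∃ (s' : ℕ) (c' : Fin s' → ℂ) (w' : Fin s' → ℂ[X]), (∀ j, (w' j).support ⊆ S) ∧
          ((X : ℂ[X]) ^ p - 1 ∣ (∑ j, C (c' j) * w' j ^ 2) - F) ∧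
          (∑ j, sqMass (c' j) (w' j)) ≤ K * (r : ℝ) ^ K * (S.card : ℝ) ^ (1 + ε) * M) :
    FeketeSOS.FeketeSOSHard :=
  feketeSOSHard_of_paleyGraphProperty_of_tameOperator
    (paleyGraphConjectureBelowHalf_iff_smallSetDiffDiscrepancy.1 hP) hT

/-- **The conjecture bounds Paley cliques by `p^{1/2−κ} + 1`** (via the engine and
`paleyClique_card_le_of_flatRIP`; unconditionally only `√(p/2)+1`, Hanson–Petridis 2021, is known).
[folklore] -/
theorem paleyClique_card_le_of_paleyGraphConjectureBelowHalf (hP : PaleyGraphConjectureBelowHalf) :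
    ∃ κ : ℝ, 0 < κ ∧ ∃ p₁ : ℕ, ∀ (p : ℕ) [Fact p.Prime], p₁ ≤ p →
      ∀ (Q : Finset ℕ), (∀ a ∈ Q, a < p) →
        (∀ a ∈ Q, ∀ b ∈ Q, a ≠ b → legendreSym p ((a : ℤ) - b) = 1) →
        (Q.card : ℝ) ≤ (p : ℝ) ^ (1 / 2 - κ) + 1 :=
  paleyClique_card_le_of_flatRIP (flatRIP_iff_paleyGraphConjectureBelowHalf.2 hP)

end

end Summit.ValiantsHypothesis.ValiantsHypothesis.Theorems
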